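import Summits.BirchSwinnertonDyer.BirchSwinnertonDyer.Theorems.EisensteinPrimesBSDpOnCellCTelescopeK2PurityCoreAtInertiaPlaces
import Literature.NumberTheory.IwasawaTheory.Greenberg2006.TwistDeformation
import HarnessLib

/-!
# Crux 4 `BSDpOnCellC` (stmt-BirchSwinnertonDyer-19034), line «telescope», workfile `Lines/telescopeK2weight2.lean` v1.2,
# sub-leaf W4⁰ (`K2Weight2.stub_bigPseudoNullPTorsion`), route G′: **THE CORE SPECIFICATION EXISTS** —
# `∃ 𝓛' ≤ 𝓛` on `Σ` with `p^a · 𝓛 ⊆ 𝓛'` on `Σ` and `𝓛'` almost `B`-divisible (input (ii′) GLOBALLY, by name)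
# (ideator seat `bsd-idea-12` gen 39; `--supports stmt-BirchSwinnertonDyer-19034 --as helper`; THEOREMS ONLY; closes nothing)

HONEST FRAMING. No registered stub, no crux, no summit statement is proved here; BSD is proved for no curve. Route G′
(memo `Cruxes/BSDpOnCellC/W-PRICING-n2.md` rev 1.9 §W4-G′) runs Greenberg 2016 Prop. 4.1.1 (c) on a CORE specification
`𝓛'` sandwiched as `p^a · 𝓛 ⊆ 𝓛' ⊆ 𝓛` (part 1 `…TelescopeK2PurityTolerantOfCore`, part 2 `…PurityCoreAtBadPrimes`,
CRK transfer `…TelescopeK2CoreCRKTransfer`). Its input (ii′) "`𝓛'` is almost divisible" was landed PLACEWISE at the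
inertia indices (`…TelescopeK2PurityCoreAtInertiaPlaces.exists_isAlmostDivisible_map_lsmul_pow_specOfIndexSet_strictSet_inr`:
at each `w ∤ p`, `w ≠ 𝔭̄`, `w ∉ Σ₀` SOME `p^{a_w} · 𝓛_w` is almost divisible). This file assembles the placewise data
into the specification itself — pure bookkeeping over the FINITE set of places of `Σ`:

* §1 `exists_core_specification` — generic: given a specification `𝓛`, a scalar `c`, a set `C` of places to be cored
  with `∀ v ∈ C ∩ Σ, ∃ a, c^a · 𝓛_v almost divisible`, and `𝓛_v` almost divisible at the other places of `Σ`, there are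
  `𝓛'` and ONE exponent `a` (the maximum over `Σ`) with `𝓛' ≤ 𝓛`, `c^a · 𝓛 ⊆ 𝓛'` on `Σ`, the shape
  `𝓛'_v = c^{b_v} · 𝓛_v` on `C` / `𝓛'_v = 𝓛_v` off `C`, and `𝓛'` almost divisible; `isStable_of_core` — such cores of a
  specification by `R`-submodules are by `R`-submodules.
* §2 the shapes of `specOfIndexSet S ρ L₀` at a finite place carrying NO index (`= ⊤`) and at a place carrying the
  strict index (`= ⊥`).
* §3 **`exists_core_specification_strictSet`** — for the descended big representation `ρ_S = descendUnramified S 𝐃 hS`,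
  `𝐃 = AnticyclotomicBigGaloisRep κ ρ` cofinitely generated over `B` (`hD`, = W1), `S` finite, and the K2 strict
  structure `𝓛 = specOfIndexSet S ρ_S (strictSet p 𝔮 Σ₀)`: GRANTED that `H¹(K_w, 𝐃)` is almost divisible at the finite
  places `w ∈ S`, `w ≠ 𝔮`, that carry no index (`w ∣ p` or `w ∈ Σ₀` — in the cell: `w = 𝔭`, a Greenberg-side row,
  [Greenberg2006] §5) and that `H¹(K_v, 𝐃) = 0` at the archimedean places (complex places; `K` imaginary quadratic in
  the cell), there exist `𝓛'` and `a` with `𝓛' ≤ 𝓛`, `p^a · 𝓛 ⊆ 𝓛'` on `Σ`, the core shape, `𝓛'_w = 𝓛_w` at the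
  finite places without inertia index, and `𝓛'` almost `B`-divisible — exactly the hypotheses `hle`/`hr` of part 1
  `forall_isPseudoNull_exists_pow_smul_eq_zero_selmer_of_core` and of `TelescopeK2CoreCRKTransfer.crk_of_core_pow`,
  the input of `isStable_of_core` (Prop. 4.1.1's "`𝓛'` by `R`-submodules"), `𝓛'_𝔭 = H¹(K_𝔭, 𝐃)` (its clause (c):
  `Q_{𝓛'}(K_𝔭) = 0` is coreflexive), and its hypothesis "`𝓛'` almost divisible".

What remains displayed for route G′ after this file: the Greenberg-side rows for `𝓛` (RFX, LEO, CRK(𝐃, 𝓛), LOC, the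
(a)/(b)/(c) clause, `H¹(K_𝔭, 𝐃)` almost divisible) feeding the named fact `prop411_selmer_isAlmostDivisible` AT `𝓛'`,
and the `X₂ ↔ S_𝓛` duality. No `def`, no `instance`, no named fact, no `sorry`. AI-typed, kernel-checked.

References: R. Greenberg, On the structure of Selmer groups (2016), §1 p. 3 L19–25, §2.5 p. 8 L35–37, Remark 3.1.2,
Prop. 4.1.1 (c), §4.2 p. 19 L25–31 [Greenberg2016Selmer]; R. Greenberg, On the structure of certain Galois cohomology
groups, Doc. Math. Extra Vol. Coates (2006), Prop. 2.4, §5 [Greenberg2006]; F. Castella, Camb. J. Math. 6 (2018), §2.1,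
and its erratum §2 [Castella2018, Castella2018Erratum].
-/

set_option linter.dupNamespace false
set_option autoImplicit false

noncomputable section

open Function
open Field IsDedekindDomain NumberField
open Literature.NumberTheory.GaloisRepresentations Literature.NumberTheory.EllipticCurves
open Literature.NumberTheory.EllipticCurves.BigGaloisRep Literature.NumberTheory.IwasawaTheory
open scoped NumberField

universe u

namespace Summit.BirchSwinnertonDyer.BirchSwinnertonDyer.Theorems.TelescopeK2CoreSpecification

/-! ## §1. Assembling placewise cores into a core specification -/

section Generic

variable {K : Type u} [Field K] [NumberField K] {S : Set (HeightOneSpectrum (𝓞 K))}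
  {Λ : Type u} [CommRing Λ] [TopologicalSpace Λ]
  {D : Type u} [AddCommGroup D] [Module Λ D] [TopologicalSpace D] [DiscreteTopology D]
  [ContinuousSMul Λ D] {ρ : ContinuousRep (GaloisGroupUnramifiedOutside K S) Λ D}

omit [TopologicalSpace Λ] in
/-- Almost divisibility is a property of the carrier: transport along an equality of submodules. [folklore] -/
theorem isAlmostDivisible_of_eq {H : Type u} [AddCommGroup H] [Module Λ H] {X Y : Submodule Λ H} (h : X = Y)
    (hX : Greenberg2016.IsAlmostDivisible Λ ↥X) : Greenberg2016.IsAlmostDivisible Λ ↥Y := by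
  subst h
  exact hX

/-- **The core specification.** `S` finite; `𝓛` a specification; `c ∈ Λ`; `C` a set of places; at every `v ∈ C ∩ Σ`
some `c^{a_v} · 𝓛_v` is almost divisible, and `𝓛_v` is almost divisible at every other `v ∈ Σ`. Then there are a
specification `𝓛'` and ONE `a : ℕ` with `𝓛'_v ≤ 𝓛_v` and `c^a · 𝓛_v ⊆ 𝓛'_v` for all `v ∈ Σ`, of the SHAPE
`𝓛'_v = 𝓛_v` off `C` and `𝓛'_v = c^{b_v} · 𝓛_v` on `C`, and `𝓛'` almost divisible (`a = max_{v ∈ Σ} b_v`, `Σ` finite).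
[cite: Greenberg2016Selmer, §2.5 p. 8 L35–37, Remark 3.1.2, §4.2 p. 19 L25–31] -/
theorem exists_core_specification (hS : S.Finite) (L : Greenberg2016.Specification S ρ) (c : Λ)
    (C : Set (Place K))
    (hC : ∀ v ∈ C, Greenberg2016.InSigma S v → ∃ a : ℕ,
      Greenberg2016.IsAlmostDivisible Λ ↥((L v).map (LinearMap.lsmul Λ _ (c ^ a))))
    (hrest : ∀ v : Place K, Greenberg2016.InSigma S v → v ∉ C →
      Greenberg2016.IsAlmostDivisible Λ ↥(L v)) :
    ∃ (L' : Greenberg2016.Specification S ρ) (a : ℕ),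
      (∀ v : Place K, Greenberg2016.InSigma S v → L' v ≤ L v) ∧
      (∀ v : Place K, Greenberg2016.InSigma S v → ∀ x ∈ L v, c ^ a • x ∈ L' v) ∧
      (∀ v : Place K, v ∉ C → L' v = L v) ∧
      (∀ v ∈ C, ∃ b : ℕ, L' v = (L v).map (LinearMap.lsmul Λ _ (c ^ b))) ∧
      L'.IsAlmostDivisible := by
  classical
  have hC' : ∀ v : Place K, ∃ a : ℕ, v ∈ C → Greenberg2016.InSigma S v →
      Greenberg2016.IsAlmostDivisible Λ ↥((L v).map (LinearMap.lsmul Λ _ (c ^ a))) := by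
    intro v
    by_cases hv : v ∈ C ∧ Greenberg2016.InSigma S v
    · obtain ⟨a, ha⟩ := hC v hv.1 hv.2
      exact ⟨a, fun _ _ => ha⟩
    · exact ⟨0, fun h₁ h₂ => (hv ⟨h₁, h₂⟩).elim⟩
  choose e he using hC'
  have hSig : {v : Place K | Greenberg2016.InSigma S v}.Finite := by
    refine ((Set.finite_range (Sum.inl : InfinitePlace K → Place K)).union
      (hS.image (Sum.inr : HeightOneSpectrum (𝓞 K) → Place K))).subset ?_
    rintro (w | v) hv
    · exact Or.inl ⟨w, rfl⟩
    · exact Or.inr ⟨v, (Greenberg2016.inSigma_inr_iff S v).1 hv, rfl⟩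
  let T : Finset (Place K) := hSig.toFinset
  have hT : ∀ v : Place K, Greenberg2016.InSigma S v → v ∈ T :=
    fun v hv => hSig.mem_toFinset.2 hv
  have hea : ∀ v : Place K, Greenberg2016.InSigma S v → e v ≤ T.sup e :=
    fun v hv => Finset.le_sup (hT v hv)
  refine ⟨fun v => if v ∈ C then (L v).map (LinearMap.lsmul Λ _ (c ^ e v)) else L v, T.sup e,
    ?_, ?_, fun v hvC => if_neg hvC, fun v hvC => ⟨e v, if_pos hvC⟩, ?_⟩
  · intro v _
    by_cases hvC : v ∈ C
    · dsimp only
      rw [if_pos hvC]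
      rintro _ ⟨x, hx, rfl⟩
      exact (L v).smul_mem _ hx
    · dsimp only
      rw [if_neg hvC]
  · intro v hv x hx
    by_cases hvC : v ∈ C
    · dsimp only
      rw [if_pos hvC]
      refine ⟨c ^ (T.sup e - e v) • x, (L v).smul_mem _ hx, ?_⟩
      rw [LinearMap.lsmul_apply, ← mul_smul, ← pow_add, Nat.add_sub_cancel' (hea v hv)]
    · dsimp only
      rw [if_neg hvC]
      exact (L v).smul_mem _ hx
  · intro v hv
    by_cases hvC : v ∈ C
    · exact isAlmostDivisible_of_eq (if_pos hvC).symm (he v hvC hv)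
    · exact isAlmostDivisible_of_eq (if_neg hvC).symm (hrest v hv hvC)

/-- **Cores of a specification by `R`-submodules are specifications by `R`-submodules**: if every `𝓛'_v`
(`v ∈ Σ`) is `𝓛_v` or some `c^b · 𝓛_v`, `c ∈ Λ`, then `𝓛` stable ⇒ `𝓛'` stable (the `R`-scalars act
`Λ`-linearly on `H¹(K_v, 𝐃)`, `localScalar`). [cite: Greenberg2016Selmer, §1 p. 3 L19–21] -/
theorem isStable_of_core {R : Type u} [CommRing R] [Module R D] [SMulCommClass R Λ D]
    (hR : ∀ (g : GaloisGroupUnramifiedOutside K S) (r : R) (d : D), ρ g (r • d) = r • ρ g d)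
    {L L' : Greenberg2016.Specification S ρ} (c : Λ)
    (hshape : ∀ v : Place K, Greenberg2016.InSigma S v →
      L' v = L v ∨ ∃ b : ℕ, L' v = (L v).map (LinearMap.lsmul Λ _ (c ^ b)))
    (hL : L.IsStable hR) : L'.IsStable hR := by
  intro v hv r z hz
  rcases hshape v hv with h | ⟨b, hb⟩
  · rw [h] at hz ⊢
    exact hL v hv r z hz
  · rw [hb] at hz ⊢
    obtain ⟨y, hy, rfl⟩ := hz
    refine ⟨Greenberg2016.localScalar S ρ v r (fun g d => hR g r d) 1 y, hL v hv r y hy, ?_⟩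
    rw [LinearMap.lsmul_apply, LinearMap.lsmul_apply, LinearMap.map_smul]

end Generic

/-! ## §2. Shapes of `specOfIndexSet` at places carrying no index / the strict index -/

section Shape

variable {K : Type} [Field K] [NumberField K] (S : Set (HeightOneSpectrum (𝓞 K)))
  {Λ : Type} [CommRing Λ] [TopologicalSpace Λ]
  {D : Type} [AddCommGroup D] [Module Λ D] [TopologicalSpace D] [DiscreteTopology D] [ContinuousSMul Λ D]
  (ρ : ContinuousRep (GaloisGroupUnramifiedOutside K S) Λ D)

/-- At a finite place carrying NO index the specification imposes no condition.
[cite: Greenberg2016Selmer, §1 p. 3 L19–25] -/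
theorem specOfIndexSet_inr_of_not_mem_of_not_mem (L₀ : Set (BigGaloisRep.LocalIndex K))
    (w : HeightOneSpectrum (𝓞 K)) (h₁ : (Sum.inl w : BigGaloisRep.LocalIndex K) ∉ L₀)
    (h₂ : (Sum.inr w : BigGaloisRep.LocalIndex K) ∉ L₀) :
    TelescopeK2SelmerDictionary.specOfIndexSet S ρ L₀ (Sum.inr w) = ⊤ := by
  refine Submodule.ext fun z => ?_
  rw [TelescopeK2SelmerDictionary.mem_specOfIndexSet_inr_iff]
  exact ⟨fun _ => Submodule.mem_top, fun _ => ⟨fun h => absurd h h₁, fun h => absurd h h₂⟩⟩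

/-- At a finite place carrying the STRICT index the specification is `0`.
[cite: Greenberg2016Selmer, §1 p. 3 L19–25] [cite: Castella2018Erratum, §2] -/
theorem specOfIndexSet_inr_of_inl_mem (L₀ : Set (BigGaloisRep.LocalIndex K))
    (w : HeightOneSpectrum (𝓞 K)) (h₁ : (Sum.inl w : BigGaloisRep.LocalIndex K) ∈ L₀) :
    TelescopeK2SelmerDictionary.specOfIndexSet S ρ L₀ (Sum.inr w) = ⊥ := by
  refine Submodule.ext fun z => ?_
  rw [TelescopeK2SelmerDictionary.mem_specOfIndexSet_inr_iff, Submodule.mem_bot]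
  exact ⟨fun h => h.1 h₁, fun h => ⟨fun _ => h, fun _ => by rw [h, map_zero]⟩⟩

/-- The strict-set shapes: at `w = 𝔮` the condition is `0`. [cite: Castella2018Erratum, §2] -/
theorem specOfIndexSet_strictSet_inr_self (p : ℕ) (𝔮 : HeightOneSpectrum (𝓞 K))
    (Sig : Set (HeightOneSpectrum (𝓞 K))) :
    TelescopeK2SelmerDictionary.specOfIndexSet S ρ (strictSet p 𝔮 Sig) (Sum.inr 𝔮) = ⊥ :=
  specOfIndexSet_inr_of_inl_mem S ρ _ 𝔮 ((inl_mem_strictSet_iff _ _ _ _).2 rfl)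

/-- The strict-set shapes: at `w ≠ 𝔮` with `w ∣ p` or `w ∈ Σ₀` there is no condition. [cite: Castella2018Erratum, §2] -/
theorem specOfIndexSet_strictSet_inr_of_noIndex (p : ℕ) (𝔮 : HeightOneSpectrum (𝓞 K))
    (Sig : Set (HeightOneSpectrum (𝓞 K))) {w : HeightOneSpectrum (𝓞 K)} (hq : w ≠ 𝔮)
    (hw : ((p : ℕ) : 𝓞 K) ∈ w.asIdeal ∨ w ∈ Sig) :
    TelescopeK2SelmerDictionary.specOfIndexSet S ρ (strictSet p 𝔮 Sig) (Sum.inr w) = ⊤ :=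
  specOfIndexSet_inr_of_not_mem_of_not_mem S ρ _ w (fun h => hq ((inl_mem_strictSet_iff _ _ _ _).1 h))
    fun h => by
      obtain ⟨h₁, h₂⟩ := (inr_mem_strictSet_iff _ _ _ _).1 h
      exact hw.elim h₂ h₁

end Shape

/-! ## §3. The core specification of the K2 strict structure for the descended big representation -/

section Strict

variable {K : Type} [Field K] [NumberField K] (p : ℕ) [Fact p.Prime]
  {A : Type} [AddCommGroup A] [Module (IwasawaAlgebra p) A] [TopologicalSpace A] [DiscreteTopology A]
  [TopologicalSpace (IwasawaAlgebra p)] [TopologicalSpace (IwasawaAlgebra₂ p)]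
  [ContinuousSMul (IwasawaAlgebra₂ p) (BigRepModule (IwasawaAlgebra p) p A)]

/-- **Route G′ input (ii′), globally: the core specification of the K2 strict structure exists.**
`𝒪 = ℤ_p⟦X⟧`, `B = 𝒪⟦T⟧`; `κ` a `ℤ_p`-extension; `𝐃 = BigRepModule 𝒪 p A` the big module of a discrete `ρ`,
cofinitely generated over `B` (`hD`); `S` finite with `ramificationSubgroup K S ≤ ker 𝐃`; `ρ_S` the descended
representation; `𝓛 = specOfIndexSet S ρ_S (strictSet p 𝔮 Σ₀)`. GRANTED `H¹(K_w, 𝐃)` almost `B`-divisible at the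
finite `w ∈ S`, `w ≠ 𝔮`, with `w ∣ p` or `w ∈ Σ₀` (`hfin`; in the cell only `w = 𝔭`) and `H¹(K_v, 𝐃) = 0` at the
archimedean `v` (`harch`), there are `𝓛' ≤ 𝓛` and `a` with `p^a · 𝓛 ⊆ 𝓛'` on `Σ`, every `𝓛'_v` equal to `𝓛_v` or to
some `p^b · 𝓛_v` (so `𝓛'` is by `R`-submodules if `𝓛` is, `isStable_of_core`), `𝓛'_w = 𝓛_w` at the finite places
carrying no inertia index (`w ∣ p`, `w ∈ Σ₀` or `w = 𝔮`; in particular `𝓛'_𝔭 = 𝓛_𝔭 = H¹(K_𝔭, 𝐃)`, so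
`Q_{𝓛'}(K_𝔭) = 0` stays coreflexive for Prop. 4.1.1 (c)), and `𝓛'` almost divisible.
[cite: Greenberg2016Selmer, §2.5 p. 8 L35–37, Remark 3.1.2, Prop. 4.1.1 (c), §4.2 p. 19 L25–31]
[cite: Greenberg2006, Prop. 2.4, §5] [cite: Castella2018Erratum, §2] -/
theorem exists_core_specification_strictSet (κ : ZpExtension K p)
    (ρ : ContinuousRep (absoluteGaloisGroup K) (IwasawaAlgebra p) A)
    (hD : Greenberg2006.IsCofinitelyGenerated (IwasawaAlgebra₂ p) (BigRepModule (IwasawaAlgebra p) p A))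
    (S : Set (HeightOneSpectrum (𝓞 K))) (hSf : S.Finite)
    (hS : ramificationSubgroup K S ≤ (AnticyclotomicBigGaloisRep κ ρ).ker)
    (𝔮 : HeightOneSpectrum (𝓞 K)) (Sig : Set (HeightOneSpectrum (𝓞 K)))
    (hfin : ∀ w ∈ S, w ≠ 𝔮 → (((p : ℕ) : 𝓞 K) ∈ w.asIdeal ∨ w ∈ Sig) →
      Greenberg2016.IsAlmostDivisible (IwasawaAlgebra₂ p)
        ↥(⊤ : Submodule (IwasawaAlgebra₂ p) ((Greenberg2016.localRep S
          (TelescopeK2RepDescent.descendUnramified S (AnticyclotomicBigGaloisRep κ ρ) hS) (Sum.inr w)).H 1)))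
    (harch : ∀ v : InfinitePlace K, Subsingleton ((Greenberg2016.localRep S
      (TelescopeK2RepDescent.descendUnramified S (AnticyclotomicBigGaloisRep κ ρ) hS) (Sum.inl v)).H 1)) :
    ∃ (L' : Greenberg2016.Specification S
        (TelescopeK2RepDescent.descendUnramified S (AnticyclotomicBigGaloisRep κ ρ) hS)) (a : ℕ),
      (∀ v : Place K, Greenberg2016.InSigma S v → L' v ≤
        TelescopeK2SelmerDictionary.specOfIndexSet S
          (TelescopeK2RepDescent.descendUnramified S (AnticyclotomicBigGaloisRep κ ρ) hS) (strictSet p 𝔮 Sig) v) ∧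
      (∀ v : Place K, Greenberg2016.InSigma S v → ∀ x ∈
        TelescopeK2SelmerDictionary.specOfIndexSet S
          (TelescopeK2RepDescent.descendUnramified S (AnticyclotomicBigGaloisRep κ ρ) hS) (strictSet p 𝔮 Sig) v,
        (((p : ℕ) : IwasawaAlgebra₂ p) ^ a) • x ∈ L' v) ∧
      (∀ v : Place K, Greenberg2016.InSigma S v →
        L' v = TelescopeK2SelmerDictionary.specOfIndexSet S
            (TelescopeK2RepDescent.descendUnramified S (AnticyclotomicBigGaloisRep κ ρ) hS) (strictSet p 𝔮 Sig) v ∨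
          ∃ b : ℕ, L' v = (TelescopeK2SelmerDictionary.specOfIndexSet S
            (TelescopeK2RepDescent.descendUnramified S (AnticyclotomicBigGaloisRep κ ρ) hS) (strictSet p 𝔮 Sig) v).map
              (LinearMap.lsmul (IwasawaAlgebra₂ p) _ (((p : ℕ) : IwasawaAlgebra₂ p) ^ b))) ∧
      (∀ w : HeightOneSpectrum (𝓞 K), (((p : ℕ) : 𝓞 K) ∈ w.asIdeal ∨ w ∈ Sig ∨ w = 𝔮) →
        L' (Sum.inr w) = TelescopeK2SelmerDictionary.specOfIndexSet S
          (TelescopeK2RepDescent.descendUnramified S (AnticyclotomicBigGaloisRep κ ρ) hS) (strictSet p 𝔮 Sig)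
            (Sum.inr w)) ∧
      L'.IsAlmostDivisible := by
  obtain ⟨L', a, hle, hr, hoff, hon, hL'⟩ := exists_core_specification hSf
    (TelescopeK2SelmerDictionary.specOfIndexSet S
      (TelescopeK2RepDescent.descendUnramified S (AnticyclotomicBigGaloisRep κ ρ) hS) (strictSet p 𝔮 Sig))
    (((p : ℕ) : IwasawaAlgebra₂ p))
    {v : Place K | ∃ w : HeightOneSpectrum (𝓞 K), v = Sum.inr w ∧ ((p : ℕ) : 𝓞 K) ∉ w.asIdeal ∧ w ≠ 𝔮 ∧ w ∉ Sig}
    (by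
      rintro v ⟨w, rfl, hw, hq, hSig⟩ _
      exact TelescopeK2PurityCoreAtInertiaPlaces.exists_isAlmostDivisible_map_lsmul_pow_specOfIndexSet_strictSet_inr
        p κ ρ hD S hS 𝔮 Sig hSig hw hq)
    (by
      rintro (v | w) hv hvC
      · haveI := harch v
        rw [TelescopeK2SelmerDictionary.specOfIndexSet_inl]
        exact Greenberg2016.isAlmostDivisible_of_subsingleton
      · by_cases hwq : w = 𝔮
        · subst hwq
          rw [specOfIndexSet_strictSet_inr_self]
          exact Greenberg2016.isAlmostDivisible_of_subsingleton
        · have hw : ((p : ℕ) : 𝓞 K) ∈ w.asIdeal ∨ w ∈ Sig := by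
            by_contra h
            exact hvC ⟨w, rfl, fun h' => h (Or.inl h'), hwq, fun h' => h (Or.inr h')⟩
          rw [specOfIndexSet_strictSet_inr_of_noIndex S _ p 𝔮 Sig hwq hw]
          exact hfin w ((Greenberg2016.inSigma_inr_iff S w).1 hv) hwq hw)
  refine ⟨L', a, hle, hr, fun v _ => ?_, fun w hw => hoff _ ?_, hL'⟩
  · by_cases hvC : v ∈ {v : Place K | ∃ w : HeightOneSpectrum (𝓞 K),
        v = Sum.inr w ∧ ((p : ℕ) : 𝓞 K) ∉ w.asIdeal ∧ w ≠ 𝔮 ∧ w ∉ Sig}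
    · exact Or.inr (hon v hvC)
    · exact Or.inl (hoff v hvC)
  · rintro ⟨w', hw', h₁, h₂, h₃⟩
    obtain rfl : w = w' := Sum.inr_injective hw'
    exact hw.elim h₁ fun h => h.elim h₃ h₂

end Strict

end Summit.BirchSwinnertonDyer.BirchSwinnertonDyer.Theorems.TelescopeK2CoreSpecification

end
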